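import Summits.HodgeConjecture.HodgeConjecture.Theorems.Ring2WeilCoverageRealGeneratorTypes
import Summits.HodgeConjecture.HodgeConjecture.Theorems.Ring2WeilCoverageCyclotomicSignaturesG10
import Summits.HodgeConjecture.HodgeConjecture.Theorems.Ring2WeilCoverageCyclotomicUnconditionalSqrtNegEleven
import Summits.HodgeConjecture.HodgeConjecture.Theorems.Ring2WeilCoverageResidueDictionaryRowsB
import HarnessLib

/-!
# Weil-type family coverage — THE QUADRATIC-SURD TYPE AT LEVEL `33` (`g = 10`): every `ℚ(√−11)`-balanced CM type of `ℚ(ζ₃₃)` (the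
# NO row `(33, √−11)`) carries a polarisation of type `((5 + √33)/2)` — a prime of `ℚ(ζ₃₃)⁺` over the unramified inert prime `2`
# — of degree `32`, whose polarised CM points lie on the NON-SPLIT tenfold row `(5, ℚ(√−11), 2)` (S-pencil); the `ℚ(√−3)`-balanced
# types do not

research route conditional on HC_CM; not a corollary; Q11.4-sentence-2 already refuted in dim ≥ 3.

Ring 2, WEIL-TYPE FAMILY-COVERAGE CENSUS (`HOME/WEIL-FAMILY-COVERAGE.md` `## b01`, blocks b01.8.3 (the `g = 10` table, rows `W10.11.a`),
b01.34 (the NO row `(33, √−11)`), b01.41; owner ring2-b01), part 54d of the `Ring2WeilCoverage*` series (part 53's engine).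
`ℚ(ζ₃₃)⁺ ∋ θ = (1 + 2ζ¹¹)(1 + 2(ζ³ + ζ⁹ + ζ¹² + ζ¹⁵ + ζ²⁷))`, `θ² = 33`, real (part 31).  `2` has order `10` mod `33` with `2⁵ ≡ −1`:
the primes of `ℚ(ζ₃₃)⁺` above `2` are INERT in `ℚ(ζ₃₃)`, and (`33 ≡ 1 (8)`: `2` splits in `ℚ(√33)`) principal with the HALF-integral
surd generator `ϖ₂ = (5 + θ)/2 = 3 + ζ¹¹ + S + 2ζ¹¹S` (`S = ζ³ + ζ⁹ + ζ¹² + ζ¹⁵ + ζ²⁷`), of norm `(25 − 33)/4 = −2 < 0` — so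
`|A_ϖ|/2 = 5` is odd and the principal verdict FLIPS (parts 48/53):

* `sq_sqrtThirtyThree'`, `complexConj_sqrtThirtyThree'` (part 31's lemmas with powers normalised), `re_sqrtThirtyThree` (**sign
  dictionary of `√33 ∈ ℚ(ζ₃₃)⁺`**: `Re σ_t(θ) < 0 ↔ t ∈ {1, 2, 4, 8, 16, 17, 25, 29, 31, 32}` — the subgroup `⟨2⟩ = ker χ₃₃`, where the
  two Gauss-sum signs of parts 27a/b agree; `(Re σ_t θ)² = 33`, `Im = 0`);
* `signSet_thirtyThree_two` (`2ϖ₂ = 5 + θ`; `Re σ_t(ϖ₂) < 0 ↔ t ∈ ⟨2⟩`; real, non-zero), `twistSetA_thirtyThree`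
  (`X = N_odd ∆ A = {2, 7, 8, 10, 14, 16, 20, 28, 29, 32}`), `span_mul_span_thirtyThree_two` (`(ϖ₂)(ϖ₂′) = (2)` in `𝓞 K`,
  `ϖ₂′ = (5 − θ)/2`: `N(𝔣₀) = 2⁵ = 32`);
* **`exists_type_thirtyThree_two_sqrt_neg_eleven`** (EVERY `ℚ(√−11)`-balanced `Φ`, every `𝔣₀` with `𝔬𝔣₀ = (ϖ₂)`: a `Φ`-positive
  divisor of type `(K; Φ; 𝔣₀)` on `ℂ^Φ/Φ(ℤ[ζ₃₃])`; `|S_Φ ∩ X| ≡ 3 + 5`), headline **`exists_surdType_thirtyThree_two_sqrt_neg_eleven`**,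
  `not_exists_type_thirtyThree_two_sqrt_neg_three` (the YES row: `|S_Φ ∩ X| ≡ 4 + 5`).

COMPONENTS (S-pencil, exact hermitian determinants, `g61/py/component_surd.py`): on the `(33, √−11)`-balanced `ℤ[ζ₃₃]`-tori the type
`((5 + √33)/2)` has `a = 32 ≡ 2`, `T(a) = {2, 11}` — **the NON-split tenfold row `(5, ℚ(√−11), 2)`** (the same row as part 52a's
ramified degree-32 type at level 44), for all 252 such CM types; on the `ℚ(√−3)`-balanced tori `a = −32 < 0`.

HONEST FRAMING: torus-level statements about Shimura's divisors of type `(K; Φ; 𝔣₀)` on `ℂ^Φ/Φ(ℤ[ζ₃₃])` [Sh98 §14.3 Prop. 4–5],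
elementary arithmetic of `ℤ[ζ₃₃]` and residue combinatorics (`decide`); the component statement is S-pencil (docstring
only); nothing here is a statement about Hodge classes, `W_K`, general members or HC; `HC_CM` is used nowhere.  No `def`, no
named fact, no `sorry`.

References: [cite: Shimura1998, §14.3 Prop. 4–5, pp. 103–104]; [cite: vanGeemen1994HodgeAV, Lemma 5.2, Thm. 5.10];
[cite: Washington1997, Lemma 4.8]; census b01.8.3 / b01.41 (seat-derived).
-/

noncomputable section

open Polynomial NumberField Complex Finset
open scoped Real nonZeroDivisors

namespace Summit.HodgeConjecture.Ring2WeilCoverage.SurdTypesLevel33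

open Literature.AlgebraicGeometry.Motives (CMType)
open Literature.AlgebraicGeometry.HodgeTheory (IsCMTypeSet)
open Literature.AlgebraicGeometry.ComplexMultiplication.CyclotomicCMType (isCMTypeSet_residueFilter exists_apply_eq_toCircle)
open Literature.NumberTheory.ComplexMultiplication
open Summit.HodgeConjecture.Ring2WeilCoverage.RealGeneratorTypes
open Summit.HodgeConjecture.Ring2WeilCoverage.RamifiedTypes (card_inter_mod_two_eq)
open Summit.HodgeConjecture.Ring2WeilCoverage.CyclotomicPrincipalObstruction (coprime_of_apply_eq_toCircle)
open Summit.HodgeConjecture.Ring2WeilCoverage.CMTypeSetOddPositions (two_mul_card_eq_card_units)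
open Summit.HodgeConjecture.Ring2WeilCoverage.CyclotomicSignaturesG10 (exists_units_sign_eq_thirtyThree)
open Summit.HodgeConjecture.Ring2WeilCoverage.CyclotomicUnconditionalSqrtNegEleven
  (sq_sqrtThirtyThree complexConj_sqrtThirtyThree norm_realUnits_pos_thirtyThree)
open Summit.HodgeConjecture.Ring2WeilCoverage.ResidueDictionaryPieces (im_embedding_sqrtNegThree_neg_iff)
open Summit.HodgeConjecture.Ring2WeilCoverage.ResidueDictionaryPiecesB (im_embedding_sqrtNegEleven_neg_iff)
open Summit.HodgeConjecture.Ring2WeilCoverage.ResidueDictionaryRowsB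
  (nK_thirtyThree_sqrt_neg_three nK_thirtyThree_sqrt_neg_eleven)

variable {K : Type} [Field K] [NumberField K] {ζ : K}

/-- `𝐞(t) = exp(2πi t/n) ∈ ℂ` (`ZMod.toCircle`). -/
local notation3 (prettyPrint := false) "𝐞 " t:max => ((ZMod.toCircle t : Circle) : ℂ)

/-- the residue set `S_Φ` read at level `33`. -/
local notation3 (prettyPrint := false) "SΦ[" Φ "," z "]" =>
  (Finset.univ.filter fun t : ZMod 33 => ∃ σ ∈ (Φ : CMType K).1, σ (z : K) = 𝐞 t)

/-- part 53's twisted set `X_A` at level `33`. -/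
local notation3 (prettyPrint := false) "XA33 " A:max =>
  (Finset.univ.filter fun t : ZMod 33 => t.val.Coprime 33 ∧
    ¬ (t ∈ (A : Finset (ZMod 33)) ↔ Even (Finset.card (Finset.filter (fun s : ZMod 33 => s.val.Coprime 33 ∧ s.val < t.val) Finset.univ))))

/-- `S = ζ³ + ζ⁹ + ζ¹² + ζ¹⁵ + ζ²⁷` (the quadratic residues mod 11, `η = ζ³`). -/
local notation3 (prettyPrint := false) "S11[" z "]" => ((z : K) ^ 3 + (z : K) ^ 9 + (z : K) ^ 12 + (z : K) ^ 15 + (z : K) ^ 27)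

/-- `θ = (1 + 2ζ¹¹)(1 + 2S)` (`θ² = 33`, real; part 31). -/
local notation3 (prettyPrint := false) "θ33[" z "]" =>
  ((1 + 2 * (z : K) ^ 11) * (1 + 2 * ((z : K) ^ 3 + (z : K) ^ 9 + (z : K) ^ 12 + (z : K) ^ 15 + (z : K) ^ 27)))

/-- `ϖ₂ = (5 + θ)/2 = 3 + ζ¹¹ + S + 2ζ¹¹S`. -/
local notation3 (prettyPrint := false) "ϖ33[" z "]" =>
  (3 + (z : K) ^ 11 + ((z : K) ^ 3 + (z : K) ^ 9 + (z : K) ^ 12 + (z : K) ^ 15 + (z : K) ^ 27) +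
    2 * (z : K) ^ 11 * ((z : K) ^ 3 + (z : K) ^ 9 + (z : K) ^ 12 + (z : K) ^ 15 + (z : K) ^ 27))

omit [NumberField K] in
/-- `θ² = 33` (part 31's `sq_sqrtThirtyThree`, powers normalised). [folklore] -/
theorem sq_sqrtThirtyThree' (hζ : IsPrimitiveRoot ζ 33) : (θ33[ζ]) ^ 2 = (33 : K) := by
  have h := sq_sqrtThirtyThree hζ
  simp only [← pow_mul, Nat.reduceMul] at h
  exact h

/-- `θ` is real (part 31's `complexConj_sqrtThirtyThree`, powers normalised). [folklore] -/
theorem complexConj_sqrtThirtyThree' [IsCMField K] (hζ : IsPrimitiveRoot ζ 33) :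
    IsCMField.complexConj K (θ33[ζ]) = θ33[ζ] := by
  have h := complexConj_sqrtThirtyThree hζ
  simp only [← pow_mul, Nat.reduceMul] at h
  exact h

omit [NumberField K] in
/-- **The sign dictionary of `√33 ∈ ℚ(ζ₃₃)⁺`**: for `φ ζ = 𝐞(t)`, `Re φ(θ) < 0 ↔ t ∈ {1, 2, 4, 8, 16, 17, 25, 29, 31, 32}` (`= ⟨2⟩ =
ker χ₃₃`: `θ = i√3·ε₃ · i√11·ε₁₁` is negative where the two Gauss-sum signs agree), `(Re φ θ)² = 33`, `Im φ θ = 0`.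
research route conditional on HC_CM; not a corollary; Q11.4-sentence-2 already refuted in dim ≥ 3. [cite: Washington1997, Lemma 4.8] -/
theorem re_sqrtThirtyThree (hζ : IsPrimitiveRoot ζ 33) {φ : K →+* ℂ} {t : ZMod 33} (hφt : φ ζ = 𝐞 t) :
    ((φ (θ33[ζ])).re < 0 ↔ t ∈ ({1, 2, 4, 8, 16, 17, 25, 29, 31, 32} : Finset (ZMod 33))) ∧ (φ (θ33[ζ])).re ^ 2 = 33 ∧
      (φ (θ33[ζ])).im = 0 := by
  have ht := coprime_of_apply_eq_toCircle hζ hφt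
  have k3 := im_embedding_sqrtNegThree_neg_iff (K := K) (n := 33) (by norm_num) hφt ht
  have k11 := im_embedding_sqrtNegEleven_neg_iff (K := K) (n := 33) (by norm_num) hφt ht
  simp only [Nat.reduceDiv, Nat.reduceMul] at k3 k11
  have i3 := nK_thirtyThree_sqrt_neg_three hφt ht
  have i11 := nK_thirtyThree_sqrt_neg_eleven hφt ht
  have him : (φ (θ33[ζ])).im = 0 := by rw [map_mul, Complex.mul_im, k3.2, k11.2]; ring
  have hre : (φ (θ33[ζ])).re = -((φ (1 + 2 * ζ ^ 11)).im * (φ (1 + 2 * S11[ζ])).im) := by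
    rw [map_mul, Complex.mul_re, k3.2, k11.2]; ring
  have y : (φ (θ33[ζ])).re ^ 2 = 33 := by
    have s := congrArg Complex.re (congrArg φ (sq_sqrtThirtyThree' hζ))
    rw [map_pow, map_ofNat, pow_two, Complex.mul_re, him] at s
    simp only [mul_zero, sub_zero, Complex.re_ofNat] at s
    rw [pow_two]; exact s
  have hdec : ∀ s : ZMod 33, s.val.Coprime 33 →
      ((s ∈ ({2, 5, 8, 14, 17, 20, 23, 26, 29, 32} : Finset (ZMod 33)) ↔
          s ∈ ({2, 7, 8, 10, 13, 17, 19, 28, 29, 32} : Finset (ZMod 33))) ↔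
        s ∈ ({1, 2, 4, 8, 16, 17, 25, 29, 31, 32} : Finset (ZMod 33))) := by
    decide
  refine ⟨?_, y, him⟩
  rw [hre, neg_lt_zero, ← hdec t ht, ← i3, ← i11]
  set a := (φ (1 + 2 * ζ ^ 11)).im with ha
  set b := (φ (1 + 2 * S11[ζ])).im with hb
  have ha0 : a ≠ 0 := k3.1.2
  have hb0 : b ≠ 0 := k11.1.2
  rcases lt_or_gt_of_ne ha0 with h1 | h1 <;> rcases lt_or_gt_of_ne hb0 with h2 | h2
  · exact ⟨fun _ => ⟨fun _ => h2, fun _ => h1⟩, fun _ => mul_pos_of_neg_of_neg h1 h2⟩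
  · exact ⟨fun h => absurd h (not_lt.mpr (mul_nonpos_of_nonpos_of_nonneg h1.le h2.le)),
      fun h => absurd (h.mp h1) (not_lt.mpr h2.le)⟩
  · exact ⟨fun h => absurd h (not_lt.mpr (mul_nonpos_of_nonneg_of_nonpos h1.le h2.le)),
      fun h => absurd (h.mpr h2) (not_lt.mpr h1.le)⟩
  · exact ⟨fun _ => ⟨fun h => absurd h (not_lt.mpr h1.le), fun h => absurd h (not_lt.mpr h2.le)⟩, fun _ => mul_pos h1 h2⟩

/-- **`ϖ₂ = (5 + θ)/2 = 3 + ζ¹¹ + S + 2ζ¹¹S` (a generator of a prime of `ℚ(ζ₃₃)⁺` over `2`, inert in `ℚ(ζ₃₃)`): `2ϖ₂ = 5 + θ`, so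
`Re φ(ϖ₂) < 0 ↔ t ∈ {1, 2, 4, 8, 16, 17, 25, 29, 31, 32}`** (`√33 > 5`); `ϖ₂` real, non-zero.
research route conditional on HC_CM; not a corollary; Q11.4-sentence-2 already refuted in dim ≥ 3. [folklore] -/
theorem signSet_thirtyThree_two [IsCMField K] (hζ : IsPrimitiveRoot ζ 33) :
    (∀ (φ : K →+* ℂ) (t : ZMod 33), φ ζ = 𝐞 t →
      ((φ (ϖ33[ζ])).re < 0 ↔ t ∈ ({1, 2, 4, 8, 16, 17, 25, 29, 31, 32} : Finset (ZMod 33)))) ∧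
    IsCMField.complexConj K (ϖ33[ζ]) = ϖ33[ζ] ∧ (ϖ33[ζ]) ≠ 0 := by
  have h2 : (2 : K) * ϖ33[ζ] = 5 + θ33[ζ] := by ring
  have key : ∀ x r : ℝ, 2 * x = 5 + r → r ^ 2 = 33 → ((x < 0 ↔ r < 0) ∧ x ≠ 0) := fun x r hx hr =>
    ⟨⟨fun h => by nlinarith, fun h => by nlinarith⟩, fun h => by subst h; nlinarith⟩
  have hre2 : ∀ φ : K →+* ℂ, 2 * (φ (ϖ33[ζ])).re = 5 + (φ (θ33[ζ])).re := fun φ => by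
    have e := congrArg φ h2
    have e1 : φ (2 * ϖ33[ζ]) = 2 * φ (ϖ33[ζ]) := by rw [map_mul, map_ofNat]
    have e2 : φ (5 + θ33[ζ]) = 5 + φ (θ33[ζ]) := by rw [map_add, map_ofNat]
    rw [e1, e2] at e
    have := congrArg Complex.re e
    simp only [Complex.mul_re, Complex.add_re, Complex.re_ofNat, Complex.im_ofNat, zero_mul, sub_zero] at this
    exact this
  refine ⟨fun φ t hφt => ?_, ?_, fun h0 => ?_⟩
  · obtain ⟨hiff, hsq, -⟩ := re_sqrtThirtyThree hζ hφt
    rw [← hiff]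
    exact (key _ _ (hre2 φ) hsq).1
  · apply mul_left_cancel₀ (two_ne_zero' K)
    rw [← map_ofNat (IsCMField.complexConj K) 2, ← map_mul, map_ofNat, h2, map_add, map_ofNat,
      complexConj_sqrtThirtyThree' hζ]
  · obtain ⟨φ⟩ := (inferInstance : Nonempty (K →+* ℂ))
    obtain ⟨t, -, hφt⟩ := exists_apply_eq_toCircle hζ φ
    obtain ⟨-, hsq, -⟩ := re_sqrtThirtyThree hζ hφt
    apply (key _ _ (hre2 φ) hsq).2
    rw [h0, map_zero, Complex.zero_re]

/-- **`X_A = N_odd ∆ A = {2, 7, 8, 10, 14, 16, 20, 28, 29, 32}` at level `33`** for `A = ⟨2⟩` (`decide`; `|N_odd ∖ X| = 5`: the flip).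
research route conditional on HC_CM; not a corollary; Q11.4-sentence-2 already refuted in dim ≥ 3. [folklore] -/
theorem twistSetA_thirtyThree :
    XA33 ({1, 2, 4, 8, 16, 17, 25, 29, 31, 32} : Finset (ZMod 33)) =
      ({2, 7, 8, 10, 14, 16, 20, 28, 29, 32} : Finset (ZMod 33)) := by
  decide

omit [NumberField K] in
/-- The integer `3 + ζ¹¹ + S + 2ζ¹¹S` of `𝓞 K` coerces to `ϖ₂`. [folklore] -/
theorem coe_surd_thirtyThree (hζ : IsPrimitiveRoot ζ 33) :
    (((3 + hζ.toInteger ^ 11 + (hζ.toInteger ^ 3 + hζ.toInteger ^ 9 + hζ.toInteger ^ 12 + hζ.toInteger ^ 15 +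
        hζ.toInteger ^ 27) + 2 * hζ.toInteger ^ 11 * (hζ.toInteger ^ 3 + hζ.toInteger ^ 9 + hζ.toInteger ^ 12 +
        hζ.toInteger ^ 15 + hζ.toInteger ^ 27) : 𝓞 K)) : K) = ϖ33[ζ] := by
  push_cast
  rfl

/-- **`(ϖ₂)·(ϖ₂′) = (2)`** in `𝓞 K`, `ϖ₂′ = (5 − θ)/2 = 2 − ζ¹¹ − S − 2ζ¹¹S` (`(25 − 33)/4 = −2`; `N(𝔣₀) = 2⁵ = 32`: degree `32`,
elementary divisors `(1⁵, 2⁵)`).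
research route conditional on HC_CM; not a corollary; Q11.4-sentence-2 already refuted in dim ≥ 3. [folklore] -/
theorem span_mul_span_thirtyThree_two (hζ : IsPrimitiveRoot ζ 33) :
    Ideal.span {(3 + hζ.toInteger ^ 11 + (hζ.toInteger ^ 3 + hζ.toInteger ^ 9 + hζ.toInteger ^ 12 + hζ.toInteger ^ 15 +
        hζ.toInteger ^ 27) + 2 * hζ.toInteger ^ 11 * (hζ.toInteger ^ 3 + hζ.toInteger ^ 9 + hζ.toInteger ^ 12 +
        hζ.toInteger ^ 15 + hζ.toInteger ^ 27) : 𝓞 K)} *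
      Ideal.span {(2 - hζ.toInteger ^ 11 - (hζ.toInteger ^ 3 + hζ.toInteger ^ 9 + hζ.toInteger ^ 12 + hζ.toInteger ^ 15 +
        hζ.toInteger ^ 27) - 2 * hζ.toInteger ^ 11 * (hζ.toInteger ^ 3 + hζ.toInteger ^ 9 + hζ.toInteger ^ 12 +
        hζ.toInteger ^ 15 + hζ.toInteger ^ 27) : 𝓞 K)} =
      Ideal.span {(2 : 𝓞 K)} := by
  have hzK : algebraMap (𝓞 K) K hζ.toInteger = ζ := rfl
  rw [Ideal.span_singleton_mul_span_singleton, ← Ideal.span_singleton_neg (2 : 𝓞 K)]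
  congr 2
  apply RingOfIntegers.ext
  push_cast; simp only [hzK, map_ofNat]
  linear_combination (-1 / 4 : K) * sq_sqrtThirtyThree' hζ

open scoped Classical in
/-- **ROW `(ℚ(ζ₃₃), ℚ(√−11))` — THE TYPE `((5 + √33)/2)` EXISTS** (→ `(5, ℚ(√−11), 2)`, degree `32`, S-pencil): for every CM type
`Φ` balanced for `N_K = {2, 7, 8, 10, 13, 17, 19, 28, 29, 32}` and every `𝔣₀` with `𝔬𝔣₀ = (ϖ₂)`, a `Φ`-positive divisor of type
`(K; Φ; 𝔣₀)` on `ℂ^Φ/Φ(ℤ[ζ₃₃])` (`|S_Φ ∩ X| ≡ |X ∖ N_K| + 5 = 3 + 5`).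
research route conditional on HC_CM; not a corollary; Q11.4-sentence-2 already refuted in dim ≥ 3. [cite: Shimura1998, §14.3 Prop. 4–5, pp. 103–104] -/
theorem exists_type_thirtyThree_two_sqrt_neg_eleven [IsCMField K] [IsCyclotomicExtension {33} ℚ K]
    (hζ : IsPrimitiveRoot ζ 33) (Φ : CMType K)
    (hbal : 2 * (SΦ[Φ, ζ] ∩ ({2, 7, 8, 10, 13, 17, 19, 28, 29, 32} : Finset (ZMod 33))).card = (SΦ[Φ, ζ]).card)
    {𝔣₀ : Ideal (𝓞 (maximalRealSubfield K))}
    (h𝔣₀ : 𝔣₀.map (algebraMap (𝓞 (maximalRealSubfield K)) (𝓞 K)) =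
      Ideal.span {(3 + hζ.toInteger ^ 11 + (hζ.toInteger ^ 3 + hζ.toInteger ^ 9 + hζ.toInteger ^ 12 + hζ.toInteger ^ 15 +
        hζ.toInteger ^ 27) + 2 * hζ.toInteger ^ 11 * (hζ.toInteger ^ 3 + hζ.toInteger ^ 9 + hζ.toInteger ^ 12 +
        hζ.toInteger ^ 15 + hζ.toInteger ^ 27) : 𝓞 K)}) :
    ∃ ζ' : K, IsCMField.complexConj K ζ' = -ζ' ∧ (∀ φ : Φ.1, 0 < (φ.1 ζ').im) ∧
        CMTypeLattice.IsOfType (1 : (FractionalIdeal (𝓞 K)⁰ K)ˣ) ζ' 𝔣₀ := by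
  have hg : Nat.totient 33 = 2 * (9 + 1) := by decide
  obtain ⟨hA, hreal, h0⟩ := signSet_thirtyThree_two hζ
  refine exists_type_of_even' hζ hg hreal h0 (coe_surd_thirtyThree hζ) hA Φ h𝔣₀ (exists_units_sign_eq_thirtyThree hζ Φ) ?_
  rw [twistSetA_thirtyThree]
  have hS := isCMTypeSet_residueFilter hζ Φ
  have hX : IsCMTypeSet 33 ({2, 7, 8, 10, 14, 16, 20, 28, 29, 32} : Finset (ZMod 33)) := by decide
  have hNK : IsCMTypeSet 33 ({2, 7, 8, 10, 13, 17, 19, 28, 29, 32} : Finset (ZMod 33)) := by decide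
  have h1 := card_inter_mod_two_eq hS hX hNK
  have h2 := two_mul_card_eq_card_units hS
  have hU : (Finset.univ.filter fun t : ZMod 33 => t.val.Coprime 33).card = 20 := by decide
  have h3 : (({2, 7, 8, 10, 14, 16, 20, 28, 29, 32} : Finset (ZMod 33)) \
      ({2, 7, 8, 10, 13, 17, 19, 28, 29, 32} : Finset (ZMod 33))).card = 3 := by decide
  rw [Nat.even_iff]
  omega

open scoped Classical in
/-- **ROW `(ℚ(ζ₃₃), ℚ(√−11))`, headline: `∃ 𝔣₀`, `𝔬𝔣₀·(ϖ₂′) = (2)`, and a `Φ`-positive divisor of type `(K; Φ; 𝔣₀)` on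
`ℂ^Φ/Φ(ℤ[ζ₃₃])`** for every `ℚ(√−11)`-balanced CM type `Φ` (degree `32`; S-pencil: on `(5, ℚ(√−11), 2)`).
research route conditional on HC_CM; not a corollary; Q11.4-sentence-2 already refuted in dim ≥ 3. [cite: Shimura1998, §14.3 Prop. 4–5, pp. 103–104] -/
theorem exists_surdType_thirtyThree_two_sqrt_neg_eleven [IsCMField K] [IsCyclotomicExtension {33} ℚ K]
    (hζ : IsPrimitiveRoot ζ 33) (Φ : CMType K)
    (hbal : 2 * (SΦ[Φ, ζ] ∩ ({2, 7, 8, 10, 13, 17, 19, 28, 29, 32} : Finset (ZMod 33))).card = (SΦ[Φ, ζ]).card) :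
    ∃ 𝔣₀ : Ideal (𝓞 (maximalRealSubfield K)),
      𝔣₀.map (algebraMap (𝓞 (maximalRealSubfield K)) (𝓞 K)) *
          Ideal.span {(2 - hζ.toInteger ^ 11 - (hζ.toInteger ^ 3 + hζ.toInteger ^ 9 + hζ.toInteger ^ 12 + hζ.toInteger ^ 15 +
            hζ.toInteger ^ 27) - 2 * hζ.toInteger ^ 11 * (hζ.toInteger ^ 3 + hζ.toInteger ^ 9 + hζ.toInteger ^ 12 +
            hζ.toInteger ^ 15 + hζ.toInteger ^ 27) : 𝓞 K)} = Ideal.span {(2 : 𝓞 K)} ∧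
      ∃ ζ' : K, IsCMField.complexConj K ζ' = -ζ' ∧ (∀ φ : Φ.1, 0 < (φ.1 ζ').im) ∧
        CMTypeLattice.IsOfType (1 : (FractionalIdeal (𝓞 K)⁰ K)ˣ) ζ' 𝔣₀ := by
  obtain ⟨-, hreal, -⟩ := signSet_thirtyThree_two hζ
  obtain ⟨𝔣₀, h𝔣₀⟩ := exists_ideal_map_eq_span (coe_surd_thirtyThree hζ) hreal
  exact ⟨𝔣₀, by rw [h𝔣₀]; exact span_mul_span_thirtyThree_two hζ,
    exists_type_thirtyThree_two_sqrt_neg_eleven hζ Φ hbal h𝔣₀⟩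

open scoped Classical in
/-- **Row `(ℚ(ζ₃₃), ℚ(√−3))` (YES for principal) does NOT carry the type `((5 + √33)/2)`** (`N_K = {2, 5, 8, 14, 17, 20, 23, 26, 29, 32}`;
THEOREM L (i) at 33 + `|S_Φ ∩ X| ≡ 4 + 5`).
research route conditional on HC_CM; not a corollary; Q11.4-sentence-2 already refuted in dim ≥ 3. [cite: Shimura1998, §14.3 Prop. 5, p. 104] -/
theorem not_exists_type_thirtyThree_two_sqrt_neg_three [IsCMField K] [IsCyclotomicExtension {33} ℚ K]
    (hζ : IsPrimitiveRoot ζ 33) (Φ : CMType K)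
    (hbal : 2 * (SΦ[Φ, ζ] ∩ ({2, 5, 8, 14, 17, 20, 23, 26, 29, 32} : Finset (ZMod 33))).card = (SΦ[Φ, ζ]).card)
    {𝔣₀ : Ideal (𝓞 (maximalRealSubfield K))}
    (h𝔣₀ : 𝔣₀.map (algebraMap (𝓞 (maximalRealSubfield K)) (𝓞 K)) =
      Ideal.span {(3 + hζ.toInteger ^ 11 + (hζ.toInteger ^ 3 + hζ.toInteger ^ 9 + hζ.toInteger ^ 12 + hζ.toInteger ^ 15 +
        hζ.toInteger ^ 27) + 2 * hζ.toInteger ^ 11 * (hζ.toInteger ^ 3 + hζ.toInteger ^ 9 + hζ.toInteger ^ 12 +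
        hζ.toInteger ^ 15 + hζ.toInteger ^ 27) : 𝓞 K)}) :
    ¬ ∃ ζ' : K, IsCMField.complexConj K ζ' = -ζ' ∧ (∀ φ : Φ.1, 0 < (φ.1 ζ').im) ∧
        CMTypeLattice.IsOfType (1 : (FractionalIdeal (𝓞 K)⁰ K)ˣ) ζ' 𝔣₀ := by
  have hg : Nat.totient 33 = 2 * (9 + 1) := by decide
  obtain ⟨hA, hreal, h0⟩ := signSet_thirtyThree_two hζ
  refine not_exists_type_of_norm_pos_of_odd' hζ hg hreal h0 (coe_surd_thirtyThree hζ) hA Φ h𝔣₀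
    (norm_realUnits_pos_thirtyThree hζ) ?_
  rw [twistSetA_thirtyThree]
  have hS := isCMTypeSet_residueFilter hζ Φ
  have hX : IsCMTypeSet 33 ({2, 7, 8, 10, 14, 16, 20, 28, 29, 32} : Finset (ZMod 33)) := by decide
  have hNK : IsCMTypeSet 33 ({2, 5, 8, 14, 17, 20, 23, 26, 29, 32} : Finset (ZMod 33)) := by decide
  have h1 := card_inter_mod_two_eq hS hX hNK
  have h2 := two_mul_card_eq_card_units hS
  have hU : (Finset.univ.filter fun t : ZMod 33 => t.val.Coprime 33).card = 20 := by decide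
  have h3 : (({2, 7, 8, 10, 14, 16, 20, 28, 29, 32} : Finset (ZMod 33)) \
      ({2, 5, 8, 14, 17, 20, 23, 26, 29, 32} : Finset (ZMod 33))).card = 4 := by decide
  rw [Nat.odd_iff]
  omega

end Summit.HodgeConjecture.Ring2WeilCoverage.SurdTypesLevel33

end
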